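import Literature.NumberTheory.Sieve.PolymathGEHCutoffJ
import Mathlib.Tactic.Ring
import Mathlib.Tactic.Linarith
import HarnessLib

/-!
# Polymath 8b, Theorem 3.15: the vanishing marginal condition, almost everywhere

Trunk AntSieve, continuation of `PolymathGEHCutoffFibres.lean` / `PolymathGEHCutoffJ.lean`
(D. H. J. Polymath, *Variants of the Selberg sieve, and bounded intervals containing many primes*,
Res. Math. Sci. 1:12 (2014) = arXiv:1407.4897, Theorem 3.15, §7.4 p. 34), toward the named fact
`Literature.NumberTheory.Sieve.weakDHL_three_two_of_GEH` (Theorem 3.2(xii)).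

Theorem 3.15 requires "`∫₀^∞ F(t₁,t₂,t₃) dt₃ = 0` whenever `t₁, t₂ ≥ 0` with `t₁ + t₂ > 1 + ε`"
(`ε = 1/4`); §7.4 reduces this (display (7.11) and the conditions (7.12)–(7.17), p. 34) to the
identical vanishing of finitely many polynomials in `(x, y)`, one for each combinatorial type of the
fibre over `{1 + ε < x + y < 3/2}`.  This file PROVES it for the cutoff `F3`, in the form consumed by
the sieve (Theorem 3.14, where the marginal is integrated again): for every coordinate direction `i`
and **almost every** `(t₁, t₂)` — precisely, off eleven lines (`badLines`: `x = 0, y = 0, x = y,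
x, y ∈ {1/4, 3/4, 5/4}, x + 2y = 3/2, 2x + y = 3/2`), which is where the fibre type changes.

* `marginal_eq_mfun` — by symmetry all three marginals are `m(t₁, t₂)`;
* `mfun_eq_zero_of_lt` — on each open type `R1, R3, R4, R5, R6, R7` the marginal polynomial of the
  Fibres file is identically zero (`Q2.isZero … = true`, kernel), `mfun_eq_zero_of_le` (`x + y ≥ 3/2`:
  empty fibre), `mfun_eq_zero_of_not_mem_badLines` (the other half-plane by `mfun_symm`);
* `volume_badLines` (`volume_line_eq_zero`) and **`marginal_ae_eq_zero`**.

## References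

* [Polymath8b2014] D. H. J. Polymath, Res. Math. Sci. 1 (2014), Art. 12 = arXiv:1407.4897,
  Theorem 3.15 (p. 11), §7.4 (p. 34, (7.11)–(7.17)).
-/

noncomputable section

open MeasureTheory Finset

namespace Literature.NumberTheory.Sieve

namespace GEHCutoff

/-! ### The vanishing marginal condition (7.8) with `ε = 1/4`, almost everywhere -/

/-- `insertNth 2 u t' = (t'₀, t'₁, u)`. [folklore] -/
theorem insertNth_two (u : ℝ) (t' : Fin 2 → ℝ) : Fin.insertNth (2 : Fin 3) u t' = ![t' 0, t' 1, u] := by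
  funext k; fin_cases k
  · exact Fin.insertNth_apply_succAbove (α := fun _ : Fin 3 => ℝ) 2 u t' 0
  · exact Fin.insertNth_apply_succAbove (α := fun _ : Fin 3 => ℝ) 2 u t' 1
  · exact Fin.insertNth_apply_same (α := fun _ : Fin 3 => ℝ) 2 u t'

/-- `insertNth 0 u t' = (u, t'₀, t'₁)`. [folklore] -/
theorem insertNth_zero' (u : ℝ) (t' : Fin 2 → ℝ) : Fin.insertNth (0 : Fin 3) u t' = ![u, t' 0, t' 1] := by
  funext k; fin_cases k
  · exact Fin.insertNth_apply_same (α := fun _ : Fin 3 => ℝ) 0 u t'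
  · exact Fin.insertNth_apply_succAbove (α := fun _ : Fin 3 => ℝ) 0 u t' 0
  · exact Fin.insertNth_apply_succAbove (α := fun _ : Fin 3 => ℝ) 0 u t' 1

/-- `insertNth 1 u t' = (t'₀, u, t'₁)`. [folklore] -/
theorem insertNth_one (u : ℝ) (t' : Fin 2 → ℝ) : Fin.insertNth (1 : Fin 3) u t' = ![t' 0, u, t' 1] := by
  funext k; fin_cases k
  · exact Fin.insertNth_apply_succAbove (α := fun _ : Fin 3 => ℝ) 1 u t' 0
  · exact Fin.insertNth_apply_same (α := fun _ : Fin 3 => ℝ) 1 u t'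
  · exact Fin.insertNth_apply_succAbove (α := fun _ : Fin 3 => ℝ) 1 u t' 1

/-- The three marginals of `F` all reduce to `m`. [cite: Polymath8b2014, Theorem 3.15] -/
theorem marginal_eq_mfun (i : Fin 3) (t' : Fin 2 → ℝ) :
    ∫ u in Set.Ioi 0, F3 (Fin.insertNth i u t') = mfun (t' 0) (t' 1) := by
  fin_cases i
  · simp only [Fin.zero_eta]
    simp_rw [insertNth_zero']
    rw [← mfun_symm]
    unfold mfun
    congr 1
    funext u
    have := F3_swap02 ![t' 1, t' 0, u]
    simpa using this
  · simp only [Fin.mk_one]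
    simp_rw [insertNth_one]
    unfold mfun
    congr 1
    funext u
    have := F3_swap12 ![t' 0, t' 1, u]
    simpa using this
  · simp only [Fin.reduceFinMk]
    simp_rw [insertNth_two]
    rfl

/-- Beyond the slanted face the fibre is empty: `m(x,y) = 0` when `x + y ≥ 3/2`. [cite: Polymath8b2014, Theorem 3.15] -/
theorem mfun_eq_zero_of_le {x y : ℝ} (h : 3 / 2 ≤ x + y) : mfun x y = 0 := by
  unfold mfun
  rw [setIntegral_congr_fun measurableSet_Ioi (g := fun _ => (0 : ℝ)) fun u hu => ?_]
  · simp
  · have hu' : (0 : ℝ) < u := hu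
    exact F3_fibre_zero (by linarith)

/-- **The marginal vanishes below the diagonal** off finitely many lines: for `0 < y < x`,
`5/4 < x + y < 3/2` and `x ≠ 3/4`, `y ≠ 1/4`, `x ≠ 5/4`, `x + 2y ≠ 3/2`, one of the fibre types
(7.12)–(7.17) applies and its polynomial is identically zero. [cite: Polymath8b2014, Section 7.4] -/
theorem mfun_eq_zero_of_lt {x y : ℝ} (h0 : 0 < y) (h1 : y < x) (h2 : 5 / 4 < x + y) (h3 : x + y < 3 / 2)
    (n1 : x ≠ 3 / 4) (n2 : y ≠ 1 / 4) (n3 : x ≠ 5 / 4) (n4 : x + 2 * y ≠ 3 / 2) : mfun x y = 0 := by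
  rcases lt_or_gt_of_ne n1 with hx | hx
  · rw [mfun_R1 h0 (by linarith) (by linarith) (by linarith) (by linarith)]
    exact ev2_eq_zero_of_isZero (by decide +kernel) x y
  rcases lt_or_gt_of_ne n2 with hy | hy
  · rcases lt_or_gt_of_ne n3 with hx5 | hx5
    · rcases lt_or_gt_of_ne n4 with hs | hs
      · rw [mfun_R4 h0 (by linarith) (by linarith) (by linarith) (by linarith) (by linarith) (by linarith)]
        exact ev2_eq_zero_of_isZero (by decide +kernel) x y
      · rw [mfun_R5 h0 (by linarith) (by linarith) (by linarith) (by linarith) (by linarith) (by linarith)]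
        exact ev2_eq_zero_of_isZero (by decide +kernel) x y
    · rcases lt_or_gt_of_ne n4 with hs | hs
      · rw [mfun_R6 h0 (by linarith) (by linarith) (by linarith) (by linarith) (by linarith)]
        exact ev2_eq_zero_of_isZero (by decide +kernel) x y
      · rw [mfun_R7 h0 (by linarith) (by linarith) (by linarith) (by linarith) (by linarith)]
        exact ev2_eq_zero_of_isZero (by decide +kernel) x y
  · rw [mfun_R3 h0 (by linarith) (by linarith) (by linarith) (by linarith) (by linarith)]
    exact ev2_eq_zero_of_isZero (by decide +kernel) x y

/-- The exceptional set: eleven lines in `ℝ²`. [folklore] -/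
def badLines : Set (Fin 2 → ℝ) :=
  {t | 1 * t 0 + 0 * t 1 = 0} ∪ {t | 0 * t 0 + 1 * t 1 = 0} ∪ {t | 1 * t 0 + (-1) * t 1 = 0} ∪
  {t | 1 * t 0 + 0 * t 1 = 3 / 4} ∪ {t | 0 * t 0 + 1 * t 1 = 3 / 4} ∪
  {t | 1 * t 0 + 0 * t 1 = 1 / 4} ∪ {t | 0 * t 0 + 1 * t 1 = 1 / 4} ∪
  {t | 1 * t 0 + 0 * t 1 = 5 / 4} ∪ {t | 0 * t 0 + 1 * t 1 = 5 / 4} ∪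
  {t | 1 * t 0 + 2 * t 1 = 3 / 2} ∪ {t | 2 * t 0 + 1 * t 1 = 3 / 2}

/-- The exceptional set is null. [folklore] -/
theorem volume_badLines : volume badLines = 0 := by
  unfold badLines
  have l := fun (a b : ℝ) (c : ℝ) (hab : a ≠ 0 ∨ b ≠ 0) => volume_line_eq_zero (a := a) (b := b) c hab
  refine measure_union_null (measure_union_null (measure_union_null (measure_union_null (measure_union_null
    (measure_union_null (measure_union_null (measure_union_null (measure_union_null (measure_union_null
    (l 1 0 0 (by norm_num)) (l 0 1 0 (by norm_num))) (l 1 (-1) 0 (by norm_num))) (l 1 0 _ (by norm_num)))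
    (l 0 1 _ (by norm_num))) (l 1 0 _ (by norm_num))) (l 0 1 _ (by norm_num))) (l 1 0 _ (by norm_num)))
    (l 0 1 _ (by norm_num))) (l 1 2 _ (by norm_num))) (l 2 1 _ (by norm_num))

/-- Off the exceptional lines, the marginal vanishes on `{x, y ≥ 0, x + y > 5/4}`. [cite: Polymath8b2014, Theorem 3.15] -/
theorem mfun_eq_zero_of_not_mem_badLines {t' : Fin 2 → ℝ} (hN : t' ∉ badLines) (hpos : ∀ j, 0 ≤ t' j)
    (hsum : (1 + 1 / 4 : ℝ) < ∑ j, t' j) : mfun (t' 0) (t' 1) = 0 := by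
  simp only [badLines, Set.mem_union, Set.mem_setOf_eq, not_or] at hN
  obtain ⟨⟨⟨⟨⟨⟨⟨⟨⟨⟨e1, e2⟩, e3⟩, e4⟩, e5⟩, e6⟩, e7⟩, e8⟩, e9⟩, e10⟩, e11⟩ := hN
  rw [Fin.sum_univ_two] at hsum
  have p0 := hpos 0
  have p1 := hpos 1
  set x := t' 0 with hx
  set y := t' 1 with hy
  rcases le_or_gt (3 / 2 : ℝ) (x + y) with hge | hlt
  · exact mfun_eq_zero_of_le hge
  have x0 : 0 < x := lt_of_le_of_ne p0 (fun h => e1 (by linarith))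
  have y0 : 0 < y := lt_of_le_of_ne p1 (fun h => e2 (by linarith))
  have hxy : x ≠ y := fun h => e3 (by linarith)
  rcases lt_or_gt_of_ne hxy with hlt' | hgt'
  · -- `x < y`: use the symmetry of `m`
    rw [← mfun_symm]
    exact mfun_eq_zero_of_lt x0 hlt' (by linarith) (by linarith) (fun h => e5 (by linarith))
      (fun h => e6 (by linarith)) (fun h => e9 (by linarith)) (fun h => e11 (by linarith))
  · exact mfun_eq_zero_of_lt y0 hgt' (by linarith) hlt (fun h => e4 (by linarith))
      (fun h => e7 (by linarith)) (fun h => e8 (by linarith)) (fun h => e10 (by linarith))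

/-- **Polymath 8b, Theorem 3.15 — the vanishing marginal condition (7.8), `ε = 1/4`**: for every
coordinate `i` and almost every `(t₁, t₂)` with `t₁, t₂ ≥ 0`, `t₁ + t₂ > 1 + ε`, the marginal
`∫₀^∞ F dt_i` vanishes (p. 11: "`∫₀^∞ F(t₁,t₂,t₃) dt₃ = 0` whenever `t₁ + t₂ > 1 + ε`", for the
symmetric `F`; we prove it off eleven lines, hence almost everywhere — the printed `F` is itself only
defined almost everywhere, "described (almost everywhere) by specifying a polynomial … on each
polytope", p. 32). [cite: Polymath8b2014, Theorem 3.15] -/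
theorem marginal_ae_eq_zero (i : Fin 3) :
    ∀ᵐ t' : Fin 2 → ℝ, (∀ j, 0 ≤ t' j) → (1 + 1 / 4 : ℝ) < ∑ j, t' j →
      ∫ u in Set.Ioi 0, F3 (Fin.insertNth i u t') = 0 := by
  have hae : ∀ᵐ t' : Fin 2 → ℝ, t' ∉ badLines := measure_eq_zero_iff_ae_notMem.1 volume_badLines
  refine hae.mono fun t' ht' hpos hsum => ?_
  rw [marginal_eq_mfun]
  exact mfun_eq_zero_of_not_mem_badLines ht' hpos hsum

end GEHCutoff

end Literature.NumberTheory.Sieve
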